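import Mathlib
import Summits.QuantumFields.BalabanUV.Beta.CoarseCoerciveTransport
import Summits.QuantumFields.BalabanUV.Beta.CoarseCoerciveBumpCalculus

/-!
# [Balaban1985BackgroundPropagators] (3.19) p. 393 ∕ (3.35) p. 396 — E-I3's ENERGY SIDE FOR COVARIANT AVERAGING:
# the covariant bond-difference operator with orthogonal transporters on a finite fibre, a BLOCK Schur test in `ℓ²`
# (fibre-dimension-free), the bond kernel of the covariant quasi-reconstruction = SLOPE × isometry + PROFILE ×
# (thin-loop HOLONOMY − 1) × isometry, hence the energy constant `E_cov = μS₁S₂ + θ₁′θ₂′` with the U = 1 overlap∕mass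
# numbers UNCHANGED and the slope data inflated by the holonomy defect `h` — the ONLY field input; assembled with
# `CoarseCoerciveTransport.massCoercive_covFamily` into `(δ²∕E_cov)‖B‖² ≤ Re B*(Q A⁻¹ Q*)B` for EVERY transport field
# (cell topic `Summits/QuantumFields/BalabanUV/Beta`; row-D4 interface item (I3), E-I3 leaves (e1)+(e2) of NOTE-I3 §5.2)

HONEST FRAMING (cell rule).  Discharging `BetaPertH` makes Bałaban's UV stability UNCONDITIONAL — a real constructive-QFT
result; NOT the continuum limit, NOT the Clay problem.  This module discharges NOTHING of `BetaPertH`.  [folklore] linear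
algebra (Cauchy–Schwarz, `R·Rᵀ = 1`), kernel-checked.  WHY: NOTE-I3 v1.1 §5.2 (`HOME/b2b-balaban-beta-an4/g39/NOTE-I3-
coarse-coercivity.md`) splits E-I3 — the bounded-energy quasi-reconstruction for Bałaban's covariant averaging (3.19)
relative to the fine form, uniform in the block size — into (m) the MASS matrix (kernel, transport-free:
`CoarseCoerciveTransport`, p221064), (e1) the SLOPE part and (e2) the thin-loop HOLONOMY part of the ENERGY.  This file is
(e1)+(e2) in abstract kernel form.  Over a fibred finite graph (sites `S`, fibre `Cp`, bonds `ι` with `src`, `tgt` and a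
real transporter `W_b`, `W_bᵀW_b = 1`) the covariant bond difference is `(D_W f)(b) = W_b f(tgt b) − f(src b)`; the
covariant quasi-reconstruction is `CoarseCoerciveTransport.covFamily t R` (IN-BLOCK scalar profile `t_y` × transport
`R_y(x)`, `R·Rᵀ = 1`).  Its bond kernel is `K b y = t_y(tgt b)·W_bR_y(tgt b)ᵀ − t_y(src b)·R_y(src b)ᵀ =
(t_y(tgt b) − t_y(src b))·[isometry] + t_y(src b)·(hol b y − 1)·[isometry]`, `hol b y = W_b·R_y(tgt b)ᵀ·R_y(src b)` the
holonomy of the thin loop (block centre → `src b` → `tgt b` → block centre); so with a bound `‖(hol b y − 1)v‖ ≤ h b y‖v‖`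
the Schur data are the U = 1 slope data with `|t_y(tgt b) − t_y(src b)|` replaced by `|t_y(tgt b) − t_y(src b)| +
|t_y(src b)|·h b y` — at `h ≡ 0` (flat transport, U = 1) EXACTLY the U = 1 calculus of `CoarseCoerciveBumpCalculus`, and for
`h ~ O(1)Mα₀·L^{−j}` on a block of side `L^j` (NOTE-I3 (e2): (3.35)'s field-strength half + [5] (52)–(53) thin contours —
LOCATED, O.2-level, NOT reproduced here) the `(1 + O(1)Mα₀)²`-type uniformity in `j`.  The Schur test is proved for
OPERATOR-NORM majorants of fibre blocks (`blockSchur`), so no fibre-dimension factor appears.  Nothing of Bałaban's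
operators is instantiated (which `W`, `R`, `h` is the instance's ∕ O.2's business; the ν-dim and general-U MODEL instances are
the MODEL crew's, beta-d4-p2); NO class change on any GAPS row (G-B9-15 decomposed, not closed); readiness width 0
unchanged; D4 DISCHARGE NO DATE; NOT summit progress.  Unit `b2b-balaban-beta-an4-g40` (owner lineage of `BINDER-OWNERS.md`
row D4); `GAPS.md` C-an4-114.

CITATION HEADER (lean-in-tree rule).  [13] = T. Bałaban, *Propagators for lattice gauge theories in a background field*,
Commun. Math. Phys. **99**, 389–434 (1985) [Balaban1985BackgroundPropagators]; p. 393 [PDF 5] (3.19) verbatim: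
*"(Q′_j(U)λ)(y) = (Q′(Ū^{j−1})·…·Q′(Ū)Q′(U)λ)(y) = Σ_{x∈B^j(y)} L^{−jd}R(U(Γ^{(j)}_{y,x}))λ(x), y ∈ T^{(j)}_{L^jη}. The contours
Γ^{(j)}_{y,x}, x ∈ B^j(y), and the contour variables U(Γ^{(j)}_{y,x}) were defined by (52), (53) in [5]."*; p. 396 [PDF 8]
(3.35) verbatim: *"for an arbitrary cube □ of the described above class, and for a configuration U there exists a gauge
transformation u on □ such that U^u = e^{iηA}, and if the index of □ is j, then |A| < O(1)Mα₀(L^jη)⁻¹, |∇^ηA| <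
O(1)Mα₀(L^jη)⁻² on □"* (renders `HOME/b2b-balaban-ref1/pages/1985-cmp99-background-propagators/…-p005-x2.png`,
`…-p008-x2.png`, READ AS IMAGES 2026-08-20 by gen 39 of this lineage, NOTE-I3 v1.1 §5.2).  LOCATOR only; nothing printed
is asserted.

WHAT IS CERTIFIED HERE (kernel, sorry-free; [folklore]).
§1 `l2` (fibre `ℓ²`-norm, `l2_sq : l2 v ^ 2 = nsq v`, triangle inequalities, homogeneity), `cpx` (complexified real fibre
   matrix), **`nsq_mulVec_cpx`**∕`l2_mulVec_cpx` (`NᵀN = 1` ⟹ isometry).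
§2 **`blockSchur`** — Schur's test for kernels of fibre operators with scalar operator-norm majorants:
   `Σ_b ‖Σ_y K b y B_y‖² ≤ R·C·Σ_y ‖B_y‖²`.
§3 `slice`, `nsq_eq_sum_slice`, **`slice_superpose_covFamily`** (`(Σ B·covFamily t R)(x,·) = Σ_y t_y(x)·R_y(x)ᵀB_y`),
   **`nsq_superpose_covFamily_le`** (mass `≤ S₁S₂‖B‖²`, the U = 1 numbers, transports free).
§4 `covDiff` + `slice_covDiff_mulVec`; `bondKernel` + `slice_covDiff_superpose_covFamily`; `hol`; **`bondKernel_decomp`**;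
   **`l2_bondKernel_mulVec_le`** (majorant `|Δ_b t_y| + |t_y(src b)|·h b y`); **`nsq_covDiff_superpose_covFamily_le`**
   (`≤ θ₁′θ₂′‖B‖²`); **`energy_superpose_covFamily_le`** (`E_cov = μS₁S₂ + θ₁′θ₂′` under covariant Gram domination).
§5 **`coarse_coercive_cov`** — the assembly with `massCoercive_covFamily` and `sandwich_coercive_of_quasiReconstruction`:
   `(δ²∕(μS₁S₂ + θ₁′θ₂′))·‖B‖² ≤ Re B*(sandwich A (covFamily s R))B` for every coarse `B`, every transport field.
NOT CLAIMED.  Any lattice instance (the counting of `S₁, S₂, θ′` on `(ℤ∕m × Fin n)^ν` and the value of `h` are the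
instance's); the multiscale form (s) of NOTE-I3 §5.2 (a-terms, Δ″); gauge covariance (g) and the uniform-`h` corollary
(sibling module `CoarseCoerciveCovariantGauge`); anything about Bałaban's operators; k-uniformity.  NOT summit progress.
PRIOR ART IN THE TREE (searched 2026-08-20: `lean search 'covDiff|holonom|blockSchur|[Cc]ovariant.*[Ll]aplac'`): T4 NE2's
`ColourCovariantLaplacian` (`covDc`∕`covLapC`: the rough covariant Laplacian as a TERM, O.2 item (i) — an object, not an
energy calculus for bump families); Literature `T4EtaRateUnitWitness.covDiff`∕`T4RelativeLadder.covDiff` (other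
namespaces, scalar∕ladder objects); `CoarseCoerciveBumpCalculus.nsq_mulVec_le_schur` (ENTRYWISE Schur — would cost
`√|Cp|` per transport); `B5Prop11Lower.nsq_mulVec_le` (operator norm).  THE NATURAL SUPPLIER OF `h`:
`Literature.….Beta.TransportVertices.norm_holonomy_sub_one_le` (`‖exp b₁⋯exp b_n − 1‖ ≤ e^s − 1`, `s = Σ‖b_j‖`, in any
complete normed algebra) and `B12Plaquette343.norm_holonomy_sub_one_le_of_size_le` — a thin loop of total plaquette size
`s` has defect `≤ e^s − 1`; turning Bałaban's (3.35) into such an `s` on a block is O.2-level and NOT done here.  No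
fibre-block Schur test and no covariant-derivative energy bound for bump families in the tree.
-/

namespace Summit.QuantumFields.BalabanUV.Beta.CoarseCoerciveCovariantEnergy

open scoped BigOperators Matrix ComplexConjugate
open Finset Matrix
open Summit.QuantumFields.BalabanUV.Beta.AccretiveCombesThomasSandwich (sandwich)
open Summit.QuantumFields.BalabanUV.Beta.UnitLatticeResolventWalk (Qm superpose)
open Summit.QuantumFields.BalabanUV.Beta.CoarseCoerciveQuasiReconstruction (sandwich_coercive_of_quasiReconstruction)
open Summit.QuantumFields.BalabanUV.Beta.CoarseCoerciveBumpCalculus (superpose_apply)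
open Summit.QuantumFields.BalabanUV.Beta.CoarseCoerciveTransport (covFamily massCoercive_covFamily)
open Literature.MathematicalPhysics.QuantumFieldTheory.Balaban1983to89.B5Prop11Lower (nsq nsq_nonneg
  star_dotProduct_self)

noncomputable section

variable {S Cp μ ι Y : Type*} [Fintype S] [Fintype Cp] [Fintype μ] [Fintype ι] [Fintype Y] [DecidableEq Cp]

/-! ## §1 The fibre `ℓ²`-norm and isometric transports -/

/-- The `ℓ²`-norm of a fibre vector (`‖·‖` of `EuclideanSpace ℂ Cp`), so that `l2 v ^ 2 = nsq v`. [folklore] -/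
def l2 (v : Cp → ℂ) : ℝ := ‖(WithLp.toLp 2 v : EuclideanSpace ℂ Cp)‖

omit [DecidableEq Cp] in
/-- `l2 ≥ 0`. [folklore] -/
theorem l2_nonneg (v : Cp → ℂ) : 0 ≤ l2 v := norm_nonneg _

omit [DecidableEq Cp] in
/-- `l2 v ^ 2 = nsq v`. [folklore] -/
theorem l2_sq (v : Cp → ℂ) : l2 v ^ 2 = nsq v := by
  rw [l2, EuclideanSpace.norm_sq_eq]
  rfl

omit [DecidableEq Cp] in
/-- Triangle inequality. [folklore] -/
theorem l2_add_le (u v : Cp → ℂ) : l2 (u + v) ≤ l2 u + l2 v := by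
  rw [l2, WithLp.toLp_add]
  exact norm_add_le _ _

omit [Fintype Y] [DecidableEq Cp] in
/-- Triangle inequality for finite sums. [folklore] -/
theorem l2_sum_le (s : Finset Y) (u : Y → Cp → ℂ) : l2 (∑ y ∈ s, u y) ≤ ∑ y ∈ s, l2 (u y) := by
  rw [l2, WithLp.toLp_sum]
  exact norm_sum_le _ _

omit [DecidableEq Cp] in
/-- Homogeneity. [folklore] -/
theorem l2_smul (c : ℂ) (v : Cp → ℂ) : l2 (c • v) = ‖c‖ * l2 v := by
  rw [l2, WithLp.toLp_smul, norm_smul]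
  rfl

/-- Complexification of a real fibre matrix (a transport `R(U(Γ))`, a bond transporter). [folklore] -/
def cpx (M : Matrix Cp Cp ℝ) : Matrix Cp Cp ℂ := Complex.ofRealHom.mapMatrix M

/-- Entries of `cpx`. [folklore] -/
theorem cpx_apply (M : Matrix Cp Cp ℝ) (a i : Cp) : cpx M a i = ((M a i : ℝ) : ℂ) := rfl

/-- `cpx` is multiplicative. [folklore] -/
theorem cpx_mul (M N : Matrix Cp Cp ℝ) : cpx (M * N) = cpx M * cpx N := map_mul _ _ _

/-- `cpx 1 = 1`. [folklore] -/
theorem cpx_one : cpx (1 : Matrix Cp Cp ℝ) = 1 := map_one _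

/-- `cpx` is additive (subtraction). [folklore] -/
theorem cpx_sub (M N : Matrix Cp Cp ℝ) : cpx (M - N) = cpx M - cpx N := map_sub _ _ _

/-- The adjoint of a complexified real matrix is the complexified transpose. [folklore] -/
theorem conjTranspose_cpx (M : Matrix Cp Cp ℝ) : (cpx M)ᴴ = cpx Mᵀ := by
  ext i j
  simp [cpx_apply, Matrix.conjTranspose_apply, Matrix.transpose_apply]

/-- **ISOMETRY**: a real matrix with orthonormal columns (`Nᵀ·N = 1`) preserves `nsq`. [folklore] -/
theorem nsq_mulVec_cpx (N : Matrix Cp Cp ℝ) (hN : Nᵀ * N = 1) (v : Cp → ℂ) : nsq (cpx N *ᵥ v) = nsq v := by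
  have h : star (cpx N *ᵥ v) ⬝ᵥ (cpx N *ᵥ v) = star v ⬝ᵥ v := by
    rw [Matrix.star_mulVec, Matrix.dotProduct_mulVec, Matrix.vecMul_vecMul, conjTranspose_cpx, ← cpx_mul, hN,
      cpx_one, Matrix.vecMul_one]
  have := congrArg Complex.re h
  rwa [star_dotProduct_self, star_dotProduct_self, Complex.ofReal_re, Complex.ofReal_re] at this

omit [DecidableEq Cp] in
/-- `l2 v = √(nsq v)`. [folklore] -/
theorem l2_eq_sqrt (v : Cp → ℂ) : l2 v = Real.sqrt (nsq v) := by
  rw [← l2_sq, Real.sqrt_sq (l2_nonneg v)]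

/-- **ISOMETRY** in `l2` form. [folklore] -/
theorem l2_mulVec_cpx (N : Matrix Cp Cp ℝ) (hN : Nᵀ * N = 1) (v : Cp → ℂ) : l2 (cpx N *ᵥ v) = l2 v := by
  rw [l2_eq_sqrt, l2_eq_sqrt, nsq_mulVec_cpx N hN]

/-! ## §2 The BLOCK Schur test in `ℓ²` (fibre-dimension-free) -/

omit [DecidableEq Cp] in
/-- **BLOCK SCHUR TEST**: a kernel of fibre operators `K b y` with scalar majorants `‖K b y v‖ ≤ k b y·‖v‖`, row sums
`Σ_y k b y ≤ R` and column sums `Σ_b k b y ≤ C` satisfies `Σ_b ‖Σ_y K b y B_y‖² ≤ R·C·Σ_y ‖B_y‖²` — no fibre-dimension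
factor (operator-norm majorants, not entries). [folklore] -/
theorem blockSchur (K : ι → Y → Matrix Cp Cp ℂ) (k : ι → Y → ℝ) (hk : ∀ b y, 0 ≤ k b y)
    (hK : ∀ b y v, l2 (K b y *ᵥ v) ≤ k b y * l2 v) {R C : ℝ} (hR0 : 0 ≤ R) (hR : ∀ b, ∑ y, k b y ≤ R)
    (hC : ∀ y, ∑ b, k b y ≤ C) (B : Y → Cp → ℂ) :
    ∑ b, nsq (∑ y, K b y *ᵥ B y) ≤ R * C * ∑ y, nsq (B y) := by
  have hrow : ∀ b, nsq (∑ y, K b y *ᵥ B y) ≤ R * ∑ y, k b y * nsq (B y) := by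
    intro b
    have h1 : l2 (∑ y, K b y *ᵥ B y) ≤ ∑ y, k b y * l2 (B y) :=
      (l2_sum_le _ _).trans (Finset.sum_le_sum fun y _ => hK b y (B y))
    have h2 : (∑ y, k b y * l2 (B y)) ^ 2 ≤ (∑ y, k b y) * ∑ y, k b y * l2 (B y) ^ 2 :=
      Finset.sum_sq_le_sum_mul_sum_of_sq_le_mul _ (fun y _ => hk b y)
        (fun y _ => mul_nonneg (hk b y) (sq_nonneg _)) (fun y _ => le_of_eq (by ring))
    have h3 : (∑ y, k b y) * ∑ y, k b y * l2 (B y) ^ 2 ≤ R * ∑ y, k b y * nsq (B y) := by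
      simp_rw [l2_sq]
      exact mul_le_mul_of_nonneg_right (hR b) (Finset.sum_nonneg fun y _ => mul_nonneg (hk b y) (nsq_nonneg _))
    rw [← l2_sq]
    exact ((pow_le_pow_left₀ (l2_nonneg _) h1 2).trans h2).trans h3
  calc ∑ b, nsq (∑ y, K b y *ᵥ B y) ≤ ∑ b, R * ∑ y, k b y * nsq (B y) := Finset.sum_le_sum fun b _ => hrow b
    _ = R * ∑ y, (∑ b, k b y) * nsq (B y) := by
        rw [← Finset.mul_sum, Finset.sum_comm]
        refine congrArg _ (Finset.sum_congr rfl fun y _ => by rw [Finset.sum_mul])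
    _ ≤ R * ∑ y, C * nsq (B y) := mul_le_mul_of_nonneg_left
        (Finset.sum_le_sum fun y _ => mul_le_mul_of_nonneg_right (hC y) (nsq_nonneg _)) hR0
    _ = R * C * ∑ y, nsq (B y) := by rw [← Finset.mul_sum, mul_assoc]

/-! ## §3 Fibre slices; the covariant family as a superposition of transported profiles -/

/-- The fibre slice of a field on a fibred index `α × Cp` at the base point `x`. [folklore] -/
def slice {α : Type*} (f : α × Cp → ℂ) (x : α) : Cp → ℂ := fun i => f (x, i)

omit [DecidableEq Cp] in
/-- `nsq` of a fibred field is the sum of the fibre `nsq`'s. [folklore] -/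
theorem nsq_eq_sum_slice {α : Type*} [Fintype α] (f : α × Cp → ℂ) : nsq f = ∑ x, nsq (slice f x) := by
  simp only [nsq, slice]
  rw [Fintype.sum_prod_type]

omit [Fintype S] in
/-- **THE COVARIANT FAMILY SUPERPOSED, FIBREWISE**: `(Σ_{(y,a)} B_{(y,a)}·covFamily t R (y,a))(x,·) =
Σ_y t_y(x)·R_y(x)ᵀ·B_y` — scalar profile times the transposed transport acting on the coarse fibre vector `B_y`.
[cite: Balaban1985BackgroundPropagators, (3.19) p.393] -/
theorem slice_superpose_covFamily (t : μ → S → ℝ) (R : μ → S → Matrix Cp Cp ℝ) (B : μ × Cp → ℂ) (x : S) :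
    slice (superpose (covFamily t R) B) x = ∑ y, (((t y x : ℝ) : ℂ) • cpx (R y x)ᵀ) *ᵥ slice B y := by
  ext i
  simp only [slice, superpose_apply, Finset.sum_apply, Matrix.smul_mulVec, Pi.smul_apply, smul_eq_mul,
    Matrix.mulVec, dotProduct, cpx_apply, Matrix.transpose_apply, covFamily]
  rw [Fintype.sum_prod_type]
  refine Finset.sum_congr rfl fun y _ => ?_
  rw [Finset.mul_sum]
  refine Finset.sum_congr rfl fun a _ => ?_
  push_cast
  ring

/-- **MASS OF THE COVARIANT SUPERPOSITION = THE U = 1 COUNT**: with `R_y(x)·R_y(x)ᵀ = 1`, overlap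
`S₁ = max_x Σ_y |t_y(x)|` and profile mass `S₂ = max_y Σ_x |t_y(x)|` give `‖Σ B·covFamily t R‖² ≤ S₁S₂‖B‖²` — the
transports are isometries and cost nothing. [folklore] -/
theorem nsq_superpose_covFamily_le (t : μ → S → ℝ) (R : μ → S → Matrix Cp Cp ℝ)
    (hR : ∀ y x, R y x * (R y x)ᵀ = 1) {S₁ S₂ : ℝ} (hS0 : 0 ≤ S₁) (hS₁ : ∀ x, ∑ y, |t y x| ≤ S₁)
    (hS₂ : ∀ y, ∑ x, |t y x| ≤ S₂) (B : μ × Cp → ℂ) :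
    nsq (superpose (covFamily t R) B) ≤ S₁ * S₂ * nsq B := by
  rw [nsq_eq_sum_slice, nsq_eq_sum_slice B]
  simp_rw [slice_superpose_covFamily]
  refine blockSchur (fun x y => ((t y x : ℝ) : ℂ) • cpx (R y x)ᵀ) (fun x y => |t y x|) (fun _ _ => abs_nonneg _)
    (fun x y v => le_of_eq ?_) hS0 hS₁ hS₂ (slice B)
  rw [Matrix.smul_mulVec, l2_smul, l2_mulVec_cpx _ (by rw [Matrix.transpose_transpose]; exact hR y x),
    Complex.norm_real, Real.norm_eq_abs]

/-! ## §4 Covariant bond differences; the bond kernel = slope × isometry + profile × (holonomy − 1) × isometry -/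

/-- **THE COVARIANT BOND-DIFFERENCE OPERATOR** of a fibred graph: bonds `b : ι` from `src b` to `tgt b` with a real
transporter `W b` on the fibre; `(D_W f)(b, a) = Σ_i W_b(a,i) f(tgt b, i) − f(src b, a)`.  With `W` = the parallel
transporters of a lattice gauge field this is the covariant derivative whose Gram form is the covariant Laplacian;
`W ≡ 1` is the U = 1 bond difference. [folklore] -/
def covDiff [DecidableEq S] (src tgt : ι → S) (W : ι → Matrix Cp Cp ℝ) : Matrix (ι × Cp) (S × Cp) ℂ :=
  fun ba xi => (if xi.1 = tgt ba.1 then ((W ba.1 ba.2 xi.2 : ℝ) : ℂ) else 0) -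
    (if xi.1 = src ba.1 ∧ xi.2 = ba.2 then 1 else 0)

omit [Fintype ι] in
/-- Fibrewise action: `(D_W f)(b, ·) = W_b·f(tgt b, ·) − f(src b, ·)`. [folklore] -/
theorem slice_covDiff_mulVec [DecidableEq S] (src tgt : ι → S) (W : ι → Matrix Cp Cp ℝ) (f : S × Cp → ℂ) (b : ι) :
    slice (covDiff src tgt W *ᵥ f) b = cpx (W b) *ᵥ slice f (tgt b) - slice f (src b) := by
  classical
  ext a
  simp only [slice, Matrix.mulVec, dotProduct, covDiff, Pi.sub_apply, cpx_apply, sub_mul,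
    Finset.sum_sub_distrib]
  rw [Fintype.sum_prod_type, Fintype.sum_prod_type]
  congr 1
  · rw [Finset.sum_eq_single (tgt b) (fun x _ hx => by simp [hx]) (by simp)]
    simp
  · rw [Finset.sum_eq_single (src b) (fun x _ hx => by simp [hx]) (by simp)]
    simp only [true_and, ite_mul, one_mul, zero_mul]
    rw [Finset.sum_ite_eq' Finset.univ a]
    simp

/-- THE BOND KERNEL of the covariant family: `K b y = t_y(tgt b)·W_b R_y(tgt b)ᵀ − t_y(src b)·R_y(src b)ᵀ`. [folklore] -/
def bondKernel (src tgt : ι → S) (W : ι → Matrix Cp Cp ℝ) (t : μ → S → ℝ) (R : μ → S → Matrix Cp Cp ℝ)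
    (b : ι) (y : μ) : Matrix Cp Cp ℂ :=
  ((t y (tgt b) : ℝ) : ℂ) • cpx (W b * (R y (tgt b))ᵀ) - ((t y (src b) : ℝ) : ℂ) • cpx (R y (src b))ᵀ

omit [Fintype ι] in
/-- `D_W(Σ B·covFamily t R)(b, ·) = Σ_y K b y · B_y`. [folklore] -/
theorem slice_covDiff_superpose_covFamily [DecidableEq S] (src tgt : ι → S) (W : ι → Matrix Cp Cp ℝ) (t : μ → S → ℝ)
    (R : μ → S → Matrix Cp Cp ℝ) (B : μ × Cp → ℂ) (b : ι) :
    slice (covDiff src tgt W *ᵥ superpose (covFamily t R) B) b = ∑ y, bondKernel src tgt W t R b y *ᵥ slice B y := by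
  classical
  rw [slice_covDiff_mulVec, slice_superpose_covFamily, slice_superpose_covFamily, Matrix.mulVec_sum,
    ← Finset.sum_sub_distrib]
  refine Finset.sum_congr rfl fun y _ => ?_
  rw [bondKernel, Matrix.sub_mulVec, Matrix.smul_mulVec, Matrix.smul_mulVec, Matrix.smul_mulVec, Matrix.mulVec_smul,
    cpx_mul, ← Matrix.mulVec_mulVec]

/-- THE THIN-LOOP HOLONOMY seen by the bond kernel: `hol b y = W_b·R_y(tgt b)ᵀ·R_y(src b)` (= 1 for a flat transport
field, e.g. U = 1). [cite: Balaban1985BackgroundPropagators, (3.19) p.393] -/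
def hol (src tgt : ι → S) (W : ι → Matrix Cp Cp ℝ) (R : μ → S → Matrix Cp Cp ℝ) (b : ι) (y : μ) :
    Matrix Cp Cp ℝ :=
  W b * (R y (tgt b))ᵀ * R y (src b)

omit [Fintype S] [Fintype μ] [Fintype ι] in
/-- **DECOMPOSITION OF THE BOND KERNEL**: with `R·Rᵀ = 1`,
`K b y = (t_y(tgt b) − t_y(src b))·W_b R_y(tgt b)ᵀ + t_y(src b)·(hol b y − 1)·R_y(src b)ᵀ` — SLOPE × isometry plus
PROFILE × (holonomy − 1) × isometry. [folklore] -/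
theorem bondKernel_decomp (src tgt : ι → S) (W : ι → Matrix Cp Cp ℝ) (t : μ → S → ℝ)
    (R : μ → S → Matrix Cp Cp ℝ) (hR : ∀ y x, R y x * (R y x)ᵀ = 1) (b : ι) (y : μ) :
    bondKernel src tgt W t R b y = ((t y (tgt b) - t y (src b) : ℝ) : ℂ) • cpx (W b * (R y (tgt b))ᵀ)
      + ((t y (src b) : ℝ) : ℂ) • cpx ((hol src tgt W R b y - 1) * (R y (src b))ᵀ) := by
  have h1 : (hol src tgt W R b y - 1) * (R y (src b))ᵀ = W b * (R y (tgt b))ᵀ - (R y (src b))ᵀ := by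
    rw [sub_mul, hol, Matrix.mul_assoc (W b * (R y (tgt b))ᵀ), hR, Matrix.mul_one, one_mul]
  rw [h1, cpx_sub, bondKernel, Complex.ofReal_sub, sub_smul, smul_sub]
  abel

omit [Fintype S] [Fintype μ] [Fintype ι] in
/-- **THE SCALAR MAJORANT OF THE BOND KERNEL**: with `R·Rᵀ = 1`, `W_bᵀW_b = 1` and a bound `h b y` on the holonomy
defect (`‖(hol b y − 1)v‖ ≤ h b y‖v‖`), `‖K b y v‖ ≤ (|t_y(tgt b) − t_y(src b)| + |t_y(src b)|·h b y)·‖v‖` — the U = 1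
slope datum plus profile × holonomy defect; `h` is the ONLY field input. [folklore] -/
theorem l2_bondKernel_mulVec_le (src tgt : ι → S) (W : ι → Matrix Cp Cp ℝ) (t : μ → S → ℝ)
    (R : μ → S → Matrix Cp Cp ℝ) (hR : ∀ y x, R y x * (R y x)ᵀ = 1) (hW : ∀ b, (W b)ᵀ * W b = 1)
    (h : ι → μ → ℝ) (hhol : ∀ b y v, l2 (cpx (hol src tgt W R b y - 1) *ᵥ v) ≤ h b y * l2 v) (b : ι) (y : μ)
    (v : Cp → ℂ) :
    l2 (bondKernel src tgt W t R b y *ᵥ v) ≤ (|t y (tgt b) - t y (src b)| + |t y (src b)| * h b y) * l2 v := by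
  have hiso1 : l2 (cpx (W b * (R y (tgt b))ᵀ) *ᵥ v) = l2 v := by
    refine l2_mulVec_cpx _ ?_ v
    rw [Matrix.transpose_mul, Matrix.transpose_transpose, Matrix.mul_assoc, ← Matrix.mul_assoc (W b)ᵀ, hW,
      Matrix.one_mul, hR]
  have hiso2 : l2 (cpx (R y (src b))ᵀ *ᵥ v) = l2 v :=
    l2_mulVec_cpx _ (by rw [Matrix.transpose_transpose]; exact hR y (src b)) v
  rw [bondKernel_decomp src tgt W t R hR, Matrix.add_mulVec, Matrix.smul_mulVec, Matrix.smul_mulVec]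
  refine (l2_add_le _ _).trans ?_
  rw [l2_smul, l2_smul, Complex.norm_real, Complex.norm_real, Real.norm_eq_abs, Real.norm_eq_abs, hiso1, cpx_mul,
    ← Matrix.mulVec_mulVec, add_mul, mul_assoc]
  gcongr
  exact (hhol b y _).trans (le_of_eq (by rw [hiso2]))

/-- **ENERGY OF THE COVARIANT SUPERPOSITION, GRAM PART**: with the majorant `k b y = |t_y(tgt b) − t_y(src b)| +
|t_y(src b)|·h b y` (`h ≥ 0`), row sums `Σ_y k b y ≤ θ₁′` and column sums `Σ_b k b y ≤ θ₂′` give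
`‖D_W(Σ B·covFamily t R)‖² ≤ θ₁′θ₂′‖B‖²`. [folklore] -/
theorem nsq_covDiff_superpose_covFamily_le [DecidableEq S] (src tgt : ι → S) (W : ι → Matrix Cp Cp ℝ) (t : μ → S → ℝ)
    (R : μ → S → Matrix Cp Cp ℝ) (hR : ∀ y x, R y x * (R y x)ᵀ = 1) (hW : ∀ b, (W b)ᵀ * W b = 1)
    (h : ι → μ → ℝ) (hh : ∀ b y, 0 ≤ h b y)
    (hhol : ∀ b y v, l2 (cpx (hol src tgt W R b y - 1) *ᵥ v) ≤ h b y * l2 v) {θ₁ θ₂ : ℝ} (hθ0 : 0 ≤ θ₁)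
    (hθ₁ : ∀ b, ∑ y, (|t y (tgt b) - t y (src b)| + |t y (src b)| * h b y) ≤ θ₁)
    (hθ₂ : ∀ y, ∑ b, (|t y (tgt b) - t y (src b)| + |t y (src b)| * h b y) ≤ θ₂) (B : μ × Cp → ℂ) :
    nsq (covDiff src tgt W *ᵥ superpose (covFamily t R) B) ≤ θ₁ * θ₂ * nsq B := by
  rw [nsq_eq_sum_slice, nsq_eq_sum_slice B]
  simp_rw [slice_covDiff_superpose_covFamily]
  exact blockSchur (bondKernel src tgt W t R) _
    (fun b y => add_nonneg (abs_nonneg _) (mul_nonneg (abs_nonneg _) (hh b y)))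
    (l2_bondKernel_mulVec_le src tgt W t R hR hW h hhol) hθ0 hθ₁ hθ₂ (slice B)

/-- **ENERGY OF THE COVARIANT QUASI-RECONSTRUCTION**: if the fine form is dominated by the covariant Gram form,
`Re z*Az ≤ μ‖z‖² + ‖D_W z‖²` (`μ ≥ 0`), then `Re ρ_B*Aρ_B ≤ (μS₁S₂ + θ₁′θ₂′)‖B‖²` for `ρ_B = Σ B·covFamily t R` —
`S₁, S₂` the U = 1 overlap∕mass numbers, `θ′` the U = 1 slope data inflated by the holonomy defect. This is the `hen`
input of `CoarseCoerciveQuasiReconstruction.sandwich_coercive_of_quasiReconstruction`. [cite: Balaban1985BackgroundPropagators, (3.35) p.396] -/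
theorem energy_superpose_covFamily_le [DecidableEq S] (A : Matrix (S × Cp) (S × Cp) ℂ) (src tgt : ι → S)
    (W : ι → Matrix Cp Cp ℝ) {μ0 : ℝ} (hμ : 0 ≤ μ0)
    (hA : ∀ z : S × Cp → ℂ, (star z ⬝ᵥ (A *ᵥ z)).re ≤ μ0 * nsq z + nsq (covDiff src tgt W *ᵥ z))
    (t : μ → S → ℝ) (R : μ → S → Matrix Cp Cp ℝ) (hR : ∀ y x, R y x * (R y x)ᵀ = 1)
    (hW : ∀ b, (W b)ᵀ * W b = 1) (h : ι → μ → ℝ) (hh : ∀ b y, 0 ≤ h b y)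
    (hhol : ∀ b y v, l2 (cpx (hol src tgt W R b y - 1) *ᵥ v) ≤ h b y * l2 v) {S₁ S₂ θ₁ θ₂ : ℝ} (hS0 : 0 ≤ S₁)
    (hS₁ : ∀ x, ∑ y, |t y x| ≤ S₁) (hS₂ : ∀ y, ∑ x, |t y x| ≤ S₂) (hθ0 : 0 ≤ θ₁)
    (hθ₁ : ∀ b, ∑ y, (|t y (tgt b) - t y (src b)| + |t y (src b)| * h b y) ≤ θ₁)
    (hθ₂ : ∀ y, ∑ b, (|t y (tgt b) - t y (src b)| + |t y (src b)| * h b y) ≤ θ₂) (B : μ × Cp → ℂ) :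
    (star (superpose (covFamily t R) B) ⬝ᵥ (A *ᵥ superpose (covFamily t R) B)).re ≤
      (μ0 * (S₁ * S₂) + θ₁ * θ₂) * nsq B := by
  have h1 := nsq_superpose_covFamily_le t R hR hS0 hS₁ hS₂ B
  have h2 := nsq_covDiff_superpose_covFamily_le src tgt W t R hR hW h hh hhol hθ0 hθ₁ hθ₂ B
  have h3 := hA (superpose (covFamily t R) B)
  nlinarith

/-! ## §5 The assembly: coarse coercivity of the covariant sandwich for EVERY transport field -/

/-- **COARSE COERCIVITY FOR A BACKGROUND FIELD, BY COUNTING + ONE HOLONOMY BOUND.**  Fine form `A` on the fibred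
lattice `S × Cp`: Hermitian, invertible, `Re`-psd, dominated by the covariant Gram form `μ‖z‖² + ‖D_W z‖²`.  Covariant
block average `q = covFamily s R` (scalar weights `s` × transport `R`) and covariant quasi-reconstruction
`r = covFamily t R` (IN-BLOCK scalar profile `t` × the SAME transport): disjoint block supports, `R·Rᵀ = 1`, `WᵀW = 1`,
block mass number `δ > 0` (`Σ_x t_y(x)s_y(x) ≥ δ`), U = 1 counting data `S₁, S₂` and holonomy-inflated slope data
`θ₁′, θ₂′`.  Then `(δ²∕(μS₁S₂ + θ₁′θ₂′))·‖B‖² ≤ Re B*(Q A⁻¹ Q*)B` for every coarse `B`.  = NOTE-I3 §5.2 (m)+(e1)+(e2)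
in kernel form: the ONLY field input is the holonomy-defect bound `h`. [cite: Balaban1985BackgroundPropagators, (3.19) p.393, (3.35) p.396] -/
theorem coarse_coercive_cov [DecidableEq S] [DecidableEq μ] (A : Matrix (S × Cp) (S × Cp) ℂ) (hH : A.IsHermitian) (hU : IsUnit A)
    (hpsd : ∀ g : S × Cp → ℂ, 0 ≤ (star g ⬝ᵥ (A *ᵥ g)).re) (src tgt : ι → S) (W : ι → Matrix Cp Cp ℝ)
    {μ0 : ℝ} (hμ : 0 ≤ μ0)
    (hA : ∀ z : S × Cp → ℂ, (star z ⬝ᵥ (A *ᵥ z)).re ≤ μ0 * nsq z + nsq (covDiff src tgt W *ᵥ z))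
    (t s : μ → S → ℝ) (hdisj : ∀ y y' x, y ≠ y' → t y x * s y' x = 0) (R : μ → S → Matrix Cp Cp ℝ)
    (hR : ∀ y x, R y x * (R y x)ᵀ = 1) (hW : ∀ b, (W b)ᵀ * W b = 1) {δ : ℝ} (hδ0 : 0 < δ)
    (hδ : ∀ y, δ ≤ ∑ x, t y x * s y x) (h : ι → μ → ℝ) (hh : ∀ b y, 0 ≤ h b y)
    (hhol : ∀ b y v, l2 (cpx (hol src tgt W R b y - 1) *ᵥ v) ≤ h b y * l2 v) {S₁ S₂ θ₁ θ₂ : ℝ} (hS0 : 0 ≤ S₁)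
    (hS₁ : ∀ x, ∑ y, |t y x| ≤ S₁) (hS₂ : ∀ y, ∑ x, |t y x| ≤ S₂) (hθ0 : 0 ≤ θ₁)
    (hθ₁ : ∀ b, ∑ y, (|t y (tgt b) - t y (src b)| + |t y (src b)| * h b y) ≤ θ₁)
    (hθ₂ : ∀ y, ∑ b, (|t y (tgt b) - t y (src b)| + |t y (src b)| * h b y) ≤ θ₂)
    (hE : 0 < μ0 * (S₁ * S₂) + θ₁ * θ₂) (B : μ × Cp → ℂ) :
    δ ^ 2 / (μ0 * (S₁ * S₂) + θ₁ * θ₂) * nsq B ≤ (star B ⬝ᵥ (sandwich A (covFamily s R) *ᵥ B)).re :=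
  sandwich_coercive_of_quasiReconstruction A hH hU hpsd (covFamily s R) (covFamily t R) hδ0 hE
    (massCoercive_covFamily t s hdisj R hR hδ)
    (energy_superpose_covFamily_le A src tgt W hμ hA t R hR hW h hh hhol hS0 hS₁ hS₂ hθ0 hθ₁ hθ₂) B

end

end Summit.QuantumFields.BalabanUV.Beta.CoarseCoerciveCovariantEnergy
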